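import Mathlib
import HarnessLib
import Literature.MathematicalPhysics.QuantumFieldTheory.ConstructiveQFTWave0
import Literature.MathematicalPhysics.QuantumLattice.AbelianFieldTensor
import Literature.MathematicalPhysics.QuantumLattice.AbelianMagneticFlux
import Literature.MathematicalPhysics.QuantumLattice.AbelianBianchiIdentity
import Summits.Ventures.LatticeQCDFlow.Scaling.TopologicalCollar
import Summits.Ventures.LatticeQCDFlow.Scaling.FluxSectorCollar
import Summits.Ventures.LatticeQCDFlow.Scaling.FluxSmallSteps
import Summits.Ventures.LatticeQCDFlow.Scaling.SliceTwistWitness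
import Summits.Ventures.LatticeQCDFlow.Scaling.ThinSectorsConnected
import Summits.Ventures.LatticeQCDFlow.Scaling.TorusCochain
import Summits.Ventures.LatticeQCDFlow.Scaling.TorusPoincareLemma

/-!
# The DeGrand–Toussaint monopole number of a compact `U(1)` lattice field, in every dimension

HONEST FRAMING: exact (Metropolis-corrected) sampling algorithms for lattice gauge theory;
figures of merit are autocorrelation/cost numbers at stated couplings and volumes; no
continuum-physics claim.

Venture `LatticeQCDFlow` (cell pub-lqcd), topic `Scaling`, FANOUT row 29 (theory2, gen-23), item 113a
(after 112a/112b `Scaling/TorusCochain`, `Scaling/TorusPoincareLemma`).  NEW WORK over Mathlib, the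
Literature files `AbelianFieldTensor` (Lüscher's field tensor `F = arg P ∈ (−π, π]`),
`AbelianBianchiIdentity` (the cube identity `plaquetteHolonomy_cube` and the lattice Bianchi identity
for admissible fields), `AbelianMagneticFlux`, and the tree's `Scaling/{TopologicalCollar,
FluxSectorCollar, FluxSmallSteps, SliceTwistWitness, ThinSectorsConnected}`; nothing here is cited as a
fact.  LITERATURE STATUS (honest): the monopole number of a cube of a compact `U(1)` lattice field is
DeGrand–Toussaint (Phys. Rev. D 22 (1980) 2478); that it vanishes for Lüscher-admissible fields
(`|F| < π/3`) is the lattice Bianchi identity [Luscher1999AbelianChiral, §2.2], already in the tree as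
`abelianFieldTensor_bianchi`.  What is added: the bookkeeping in every dimension `d` and at every
CHORDAL threshold `ε` of the cell's metric tunnelling laws — integrality for EVERY configuration,
continuity off the cut, hence constancy on the connected components ("`ε`-sectors") of the `ε`-thin
set for `ε ≤ 2`, and the identification of the chordal threshold `ε = 1` with Lüscher admissibility
(`2 sin(π/6) = 1`).  Grade: formalisation of a known mechanism; no new theorem of physics.

CONTENTS.  §1 `ThinSet d L ε = {W | every plaquette (x; μ<ν) has dist(P,1) < ε}` ⊆ `GaugeConfig d L
Circle` (for `d = 2` literally `Thin L ε` of `Scaling/SliceTwistWitness`); every configuration is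
`ε`-thin for `ε > 2`; for `ε ≤ 2` a thin configuration has NO plaquette equal to `−1` in any index
order, so its field tensor is antisymmetric (`abelianFieldTensor_swap_of_thin`) with zero diagonal; for
`ε ≤ 1` it is admissible, `|F| < π/3` (`abs_abelianFieldTensor_lt_of_thin`).  §2 lifts `U = exp(i a)`
and the integer parts `curl a = F + 2π m` in every index pair (`exists_int_curl_eq`, general-`d` form
of item 110's).  §3 THE MONOPOLE NUMBER `monopole U x ν ρ σ = (2π)⁻¹·cob F (x; ν,ρ,σ)`
(`cob` = the cube coboundary of `Scaling/TorusPoincareLemma`, the cyclic form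
`Δ_ν F_{ρσ} + Δ_ρ F_{σν} + Δ_σ F_{νρ}`; off the cut this is `(2π)⁻¹ (dF)_{νρσ}`): an INTEGER for every
configuration (`exists_int_eq_monopole`, from `plaquetteHolonomy_cube`); ZERO for admissible fields
and hence on `ThinSet d L ε`, `ε ≤ 1` (`monopole_eq_zero_of_thin`); continuous at configurations
without `−1` plaquettes; CONSTANT ON `ε`-SECTORS for `ε ≤ 2`
(`monopole_eq_of_mem_connectedComponentIn`: a continuous integer-valued function on a preconnected
space).  §4 chord control along a segment of plaquette angles (general-`d` copy of item 110's
`dist_exp_lineComb_one_le`) and continuity of exponentiated segments of link fields — the two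
inputs of the sufficiency theorem of item 113b `Scaling/MonopoleSectors`.

No `sorry`, no new axioms, no `opaque`; standard axioms only.
-/

noncomputable section

namespace Summit.Ventures.LatticeQCDFlow.Theory2.Lattice.Flux.MonopoleSectors

open Metric Set Filter Topology Real Finset
open Literature.MathematicalPhysics.QuantumFieldTheory Literature.MathematicalPhysics.QuantumLattice
open Summit.Ventures.LatticeQCDFlow.Theory2.Lattice.Flux.TorusCochain
open Summit.Ventures.LatticeQCDFlow.Theory2.Lattice.Flux.ThinSectors (abs_lineComb_le dist_exp_one_mono_abs)

variable {d L : ℕ}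

/-! ## §1. The `ε`-thin set in every dimension -/

/-- The `ε`-thin set of `U(1)` configurations on `(ℤ/L)^d`: every plaquette within chordal distance
`ε` of `1` (for `d = 2` this is `Thin L ε` of `Scaling/SliceTwistWitness`). [folklore] -/
def ThinSet (d L : ℕ) (ε : ℝ) : Set (GaugeConfig d L Circle) :=
  {W | ∀ p : Plaquette d L, dist (plaquetteHolonomy W p.1 p.2.1.1 p.2.1.2) 1 < ε}

/-- In two dimensions the thin set is the one of `Scaling/SliceTwistWitness`. [folklore] -/
theorem thinSet_two (L : ℕ) (ε : ℝ) : ThinSet 2 L ε = Thin L ε := rfl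

/-- Every plaquette is within chordal distance `2` of `1`. [folklore] -/
theorem dist_plaquetteHolonomy_one_le_two (W : GaugeConfig d L Circle) (x : Site d L) (μ ν : Fin d) :
    dist (plaquetteHolonomy W x μ ν) 1 ≤ 2 := by
  rw [U1.dist_eq_norm_coe, Circle.coe_one]
  calc ‖((plaquetteHolonomy W x μ ν : Circle) : ℂ) - 1‖
      ≤ ‖((plaquetteHolonomy W x μ ν : Circle) : ℂ)‖ + ‖(1 : ℂ)‖ := norm_sub_le _ _
    _ = 2 := by rw [Circle.norm_coe, norm_one]; norm_num

/-- For `ε > 2` every configuration is thin. [folklore] -/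
theorem mem_thinSet_of_two_lt {ε : ℝ} (hε : 2 < ε) (W : GaugeConfig d L Circle) : W ∈ ThinSet d L ε :=
  fun p => (dist_plaquetteHolonomy_one_le_two W p.1 _ _).trans_lt hε

/-- The degenerate plaquette is trivial: `P(x, μ, μ) = 1`. [folklore] -/
theorem plaquetteHolonomy_self {G : Type*} [Group G] (W : GaugeConfig d L G) (x : Site d L) (μ : Fin d) :
    plaquetteHolonomy W x μ μ = 1 := by
  simp [plaquetteHolonomy]

/-- `F_{μμ} = 0`. [folklore] -/
theorem abelianFieldTensor_self (W : GaugeConfig d L Circle) (x : Site d L) (μ : Fin d) :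
    abelianFieldTensor W x μ μ = 0 := by
  rw [abelianFieldTensor, plaquetteHolonomy_self, Circle.coe_one, Complex.arg_one]

/-- `exp(iπ) = −1` on the circle. [folklore] -/
theorem circleExp_pi : Circle.exp π = -1 := by
  ext
  rw [Circle.coe_exp, Circle.coe_neg, Circle.coe_one]
  exact Complex.exp_pi_mul_I

/-- A thin configuration (`ε ≤ 2`) has no plaquette equal to `−1`, in any index order. [folklore] -/
theorem plaquetteHolonomy_ne_neg_one_of_thin {ε : ℝ} (hε : ε ≤ 2) {W : GaugeConfig d L Circle}
    (hW : W ∈ ThinSet d L ε) (x : Site d L) (μ ν : Fin d) : plaquetteHolonomy W x μ ν ≠ -1 := by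
  have hlt : ∀ {α β : Fin d}, α < β → plaquetteHolonomy W x α β ≠ -1 := by
    intro α β hαβ h
    have h1 := hW ⟨x, ⟨(α, β), hαβ⟩⟩
    simp only at h1
    rw [h, U1.dist_eq_norm_coe, Circle.coe_neg, Circle.coe_one] at h1
    norm_num at h1
    linarith
  rcases lt_trichotomy μ ν with h | h | h
  · exact hlt h
  · subst h; rw [plaquetteHolonomy_self]
    intro h1
    have h2 := congrArg (fun z : Circle => (z : ℂ)) h1
    simp only [Circle.coe_one, Circle.coe_neg] at h2
    norm_num at h2
  · rw [plaquetteHolonomy_swap_eq_inv W x ν μ]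
    intro h1
    apply hlt h
    rw [← inv_inv (plaquetteHolonomy W x ν μ), h1]
    ext
    simp [Circle.coe_neg, Circle.coe_one]

/-- A thin configuration (`ε ≤ 2`) has no field tensor component equal to `π`. [folklore] -/
theorem abelianFieldTensor_ne_pi_of_thin {ε : ℝ} (hε : ε ≤ 2) {W : GaugeConfig d L Circle}
    (hW : W ∈ ThinSet d L ε) (x : Site d L) (μ ν : Fin d) : abelianFieldTensor W x μ ν ≠ π := by
  intro h
  apply plaquetteHolonomy_ne_neg_one_of_thin hε hW x μ ν
  rw [← exp_abelianFieldTensor, h, circleExp_pi]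

/-- On the thin set (`ε ≤ 2`) the field tensor is antisymmetric in every index pair. [folklore] -/
theorem abelianFieldTensor_swap_of_thin {ε : ℝ} (hε : ε ≤ 2) {W : GaugeConfig d L Circle}
    (hW : W ∈ ThinSet d L ε) (x : Site d L) (μ ν : Fin d) :
    abelianFieldTensor W x ν μ = -abelianFieldTensor W x μ ν :=
  abelianFieldTensor_swap W x μ ν (abelianFieldTensor_ne_pi_of_thin hε hW x μ ν)

/-- `dist(exp(iπ/3), 1) = 1`: the chord of the admissibility angle. [folklore] -/
theorem dist_circleExp_pi_div_three : dist (Circle.exp (π / 3)) 1 = 1 := by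
  rw [dist_exp_one_eq, show π / 3 / 2 = π / 6 by ring, Real.sin_pi_div_six]
  norm_num

/-- **Chordal threshold `1` is Lüscher admissibility**: on the `ε`-thin set with `ε ≤ 1` every
field tensor component is `< π/3` in absolute value. [cite: Luscher1999AbelianChiral, §2.2] [folklore] -/
theorem abs_abelianFieldTensor_lt_of_thin {ε : ℝ} (hε : ε ≤ 1) {W : GaugeConfig d L Circle}
    (hW : W ∈ ThinSet d L ε) (y : Site d L) (α β : Fin d) :
    |abelianFieldTensor W y α β| < π / 3 := by
  have hlt : ∀ {α β : Fin d}, α < β → |abelianFieldTensor W y α β| < π / 3 := by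
    intro α β hαβ
    by_contra hge
    rw [not_lt] at hge
    have h1 := hW ⟨y, ⟨(α, β), hαβ⟩⟩
    simp only at h1
    have hmono := dist_exp_one_mono_abs (θ := π / 3) (φ := abelianFieldTensor W y α β)
      (by rw [abs_of_pos (by positivity)]; exact hge) (abs_abelianFieldTensor_le_pi W y α β)
    rw [dist_circleExp_pi_div_three, exp_abelianFieldTensor] at hmono
    linarith
  rcases lt_trichotomy α β with h | h | h
  · exact hlt h
  · subst h; rw [abelianFieldTensor_self, abs_zero]; positivity
  · rw [abelianFieldTensor_swap_of_thin (hε.trans (by norm_num)) hW y β α, abs_neg]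
    exact hlt h

/-! ## §2. Lifts and the integer parts of the plaquette angles -/

/-- The plaquette of an exponentiated link field is the exponential of its curl. [folklore] -/
theorem plaquetteHolonomy_exp (a : Edge d L → ℝ) (x : Site d L) (μ ν : Fin d) :
    plaquetteHolonomy (fun e => Circle.exp (a e)) x μ ν = Circle.exp (curl a x μ ν) := by
  have h : curl a x μ ν = a (x, μ) + a (x.shift μ, ν) + -a (x.shift ν, μ) + -a (x, ν) := by
    simp only [curl]; ring
  rw [h]
  simp only [plaquetteHolonomy, Circle.exp_add, Circle.exp_neg]

/-- Every configuration has a lift `U_e = exp(i a_e)`. [folklore] -/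
theorem exists_lift (U : GaugeConfig d L Circle) : ∃ a : Edge d L → ℝ, ∀ e, Circle.exp (a e) = U e :=
  ⟨fun e => Complex.arg (U e : ℂ), fun e => Circle.exp_arg (U e)⟩

/-- The plaquette angle of a lift is the field tensor plus an integer multiple of `2π`, in every
index pair. [cite: Luscher1999AbelianTopology, eq. (3.4)] [folklore] -/
theorem exists_int_curl_eq {U : GaugeConfig d L Circle} {a : Edge d L → ℝ}
    (ha : ∀ e, Circle.exp (a e) = U e) (x : Site d L) (μ ν : Fin d) :
    ∃ m : ℤ, curl a x μ ν = abelianFieldTensor U x μ ν + m * (2 * π) :=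
  by
  have h := plaquetteHolonomy_exp a x μ ν
  rw [show (fun e => Circle.exp (a e)) = U from funext ha] at h
  exact Circle.exp_eq_exp.mp (by rw [← h, exp_abelianFieldTensor])

/-- The curl is affine along segments of link fields. [folklore] -/
theorem curl_lineComb (a b : Edge d L → ℝ) (t : ℝ) (x : Site d L) (μ ν : Fin d) :
    curl (fun e => a e + t * (b e - a e)) x μ ν = curl a x μ ν + t * (curl b x μ ν - curl a x μ ν) := by
  simp only [curl]; ring

/-- The curl of a lift corrected by `c·k`, `k` integer. [folklore] -/
theorem curl_sub_const_mul (a : Edge d L → ℝ) (k : Edge d L → ℤ) (c : ℝ) (x : Site d L) (μ ν : Fin d) :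
    curl (fun e => a e - c * k e) x μ ν = curl a x μ ν - c * curl k x μ ν := by
  simp only [curl]; push_cast; ring

/-! ## §3. The DeGrand–Toussaint monopole number of a cube -/

/-- **The monopole number** of the cube at `x` spanned by `ν, ρ, σ`:
`n = (2π)⁻¹ (Δ_ν F_{ρσ} + Δ_ρ F_{σν} + Δ_σ F_{νρ})`, the lattice exterior derivative of Lüscher's
field tensor through the cube, in units of `2π` (DeGrand–Toussaint).  Off the cut (`F`
antisymmetric, e.g. on the `ε`-thin set with `ε ≤ 2`) this is `(2π)⁻¹ (dF)_{νρσ}`.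
[cite: DeGrandToussaint1980, eq. (5)] [cite: Luscher1999AbelianChiral, §2.2] [folklore] -/
def monopole (U : GaugeConfig d L Circle) (x : Site d L) (ν ρ σ : Fin d) : ℝ :=
  cob (abelianFieldTensor U) x ν ρ σ / (2 * π)

/-- **Monopole numbers are integers**, for every configuration (the cube identity). [folklore] -/
theorem exists_int_eq_monopole (U : GaugeConfig d L Circle) (x : Site d L) (ν ρ σ : Fin d) :
    ∃ n : ℤ, monopole U x ν ρ σ = n := by
  have hexp : Circle.exp (cob (abelianFieldTensor U) x ν ρ σ) = 1 := by
    simp only [cob, Circle.exp_add, Circle.exp_sub, exp_abelianFieldTensor, div_eq_mul_inv]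
    exact plaquetteHolonomy_cube U x ν ρ σ
  obtain ⟨n, hn⟩ := Circle.exp_eq_one.mp hexp
  refine ⟨n, ?_⟩
  rw [monopole, hn]
  field_simp

/-- **Admissible fields carry no monopoles** (`|F| < π/3` everywhere): the lattice Bianchi identity.
[cite: Luscher1999AbelianChiral, §2.2] [folklore] -/
theorem monopole_eq_zero_of_admissible {U : GaugeConfig d L Circle}
    (hF : ∀ (y : Site d L) (α β : Fin d), |abelianFieldTensor U y α β| < π / 3)
    (x : Site d L) (ν ρ σ : Fin d) : monopole U x ν ρ σ = 0 := by
  rw [monopole, cob, abelianFieldTensor_bianchi U x ν ρ σ hF, zero_div]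

/-- **Below the chordal threshold `1` there are no monopoles.** [folklore] -/
theorem monopole_eq_zero_of_thin {ε : ℝ} (hε : ε ≤ 1) {W : GaugeConfig d L Circle}
    (hW : W ∈ ThinSet d L ε) (x : Site d L) (ν ρ σ : Fin d) : monopole W x ν ρ σ = 0 :=
  monopole_eq_zero_of_admissible (abs_abelianFieldTensor_lt_of_thin hε hW) x ν ρ σ

/-- The monopole number is continuous at every configuration without plaquettes equal to `−1`.
[folklore] -/
theorem continuousAt_monopole {U : GaugeConfig d L Circle}
    (hU : ∀ (y : Site d L) (α β : Fin d), plaquetteHolonomy U y α β ≠ -1) (x : Site d L)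
    (ν ρ σ : Fin d) : ContinuousAt (fun V : GaugeConfig d L Circle => monopole V x ν ρ σ) U := by
  unfold monopole cob
  have h := fun y α β => continuousAt_abelianFieldTensor (hU y α β)
  exact ((((h _ _ _).sub (h _ _ _)).add ((h _ _ _).sub (h _ _ _))).add
    ((h _ _ _).sub (h _ _ _))).div_const _

/-- A continuous integer-valued real function on a preconnected space is constant. [folklore] -/
theorem apply_eq_of_continuous_of_intValued {Y : Type*} [TopologicalSpace Y] [PreconnectedSpace Y]
    {f : Y → ℝ} (hf : Continuous f) (hZ : ∀ y, ∃ n : ℤ, f y = n) (y y' : Y) : f y = f y' := by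
  have key : ∀ z z' : Y, ¬ f z < f z' := by
    intro z z' hlt
    obtain ⟨n, hn⟩ := hZ z
    obtain ⟨n', hn'⟩ := hZ z'
    have hnn : n < n' := by
      have : (n : ℝ) < n' := by rw [← hn, ← hn']; exact hlt
      exact_mod_cast this
    have hmem : ((n : ℝ) + 1 / 2) ∈ Icc (f z) (f z') := by
      rw [hn, hn']
      have : (n : ℝ) + 1 ≤ n' := by exact_mod_cast hnn
      exact ⟨by linarith, by linarith⟩
    obtain ⟨w, hw⟩ := intermediate_value_univ z z' hf hmem
    obtain ⟨k, hk⟩ := hZ w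
    rw [hk] at hw
    have h2 : (2 * k : ℤ) = 2 * n + 1 := by
      have : (2 * k : ℝ) = 2 * n + 1 := by rw [hw]; ring
      exact_mod_cast this
    omega
  rcases lt_trichotomy (f y) (f y') with h | h | h
  · exact absurd h (key y y')
  · exact h
  · exact absurd h (key y' y)

/-- **Monopole numbers are constant on `ε`-sectors** (`ε ≤ 2`): two configurations in the same
connected component of the thin set have the same monopole number in every cube. [folklore] -/
theorem monopole_eq_of_mem_connectedComponentIn {ε : ℝ} (hε : ε ≤ 2) {U U' : GaugeConfig d L Circle}
    (h : U' ∈ connectedComponentIn (ThinSet d L ε) U) (x : Site d L) (ν ρ σ : Fin d) :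
    monopole U' x ν ρ σ = monopole U x ν ρ σ := by
  set S := connectedComponentIn (ThinSet d L ε) U with hS
  have hUS : U ∈ S := mem_connectedComponentIn (connectedComponentIn_nonempty_iff.mp ⟨U', h⟩ : U ∈ ThinSet d L ε)
  haveI : PreconnectedSpace S :=
    isPreconnected_iff_preconnectedSpace.mp isPreconnected_connectedComponentIn
  have hc : Continuous fun W : S => monopole (W : GaugeConfig d L Circle) x ν ρ σ :=
    continuous_iff_continuousAt.2 fun W =>
      (continuousAt_monopole (plaquetteHolonomy_ne_neg_one_of_thin hε
        (connectedComponentIn_subset _ _ W.2)) x ν ρ σ).comp continuous_subtype_val.continuousAt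
  exact apply_eq_of_continuous_of_intValued hc (fun W => exists_int_eq_monopole _ x ν ρ σ)
    ⟨U', h⟩ ⟨U, hUS⟩

/-! ## §4. Chord control along a segment of plaquette angles -/

/-- Along the segment of plaquette angles `(1−t)F + tF'` the plaquette stays at least as close to
`1` as the farther endpoint plaquette. [folklore] -/
theorem dist_exp_lineComb_one_le (U U' : GaugeConfig d L Circle) (x : Site d L) (μ ν : Fin d) {t : ℝ}
    (ht : t ∈ Icc (0 : ℝ) 1) :
    dist (Circle.exp (abelianFieldTensor U x μ ν +
        t * (abelianFieldTensor U' x μ ν - abelianFieldTensor U x μ ν))) 1 ≤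
      max (dist (plaquetteHolonomy U x μ ν) 1) (dist (plaquetteHolonomy U' x μ ν) 1) := by
  rcases le_total |abelianFieldTensor U x μ ν| |abelianFieldTensor U' x μ ν| with hle | hle
  · refine le_trans ?_ (le_max_right _ _)
    rw [← exp_abelianFieldTensor U']
    exact dist_exp_one_mono_abs ((abs_lineComb_le ht).trans (max_eq_right hle).le)
      (abs_abelianFieldTensor_le_pi U' x μ ν)
  · refine le_trans ?_ (le_max_left _ _)
    rw [← exp_abelianFieldTensor U]
    exact dist_exp_one_mono_abs ((abs_lineComb_le ht).trans (max_eq_left hle).le)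
      (abs_abelianFieldTensor_le_pi U x μ ν)

/-- The exponentiated segment between two link fields is a continuous path. [folklore] -/
theorem continuous_expSegment (a b : Edge d L → ℝ) :
    Continuous fun t : ℝ => (fun e => Circle.exp (a e + t * (b e - a e)) : GaugeConfig d L Circle) := by
  refine continuous_pi fun e => ?_
  have hc : Continuous fun t : ℝ => a e + t * (b e - a e) := by fun_prop
  exact Circle.exp.continuous.comp hc

end Summit.Ventures.LatticeQCDFlow.Theory2.Lattice.Flux.MonopoleSectors

end
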